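/-
Copyright (c) 2026. All rights reserved.
Released under Apache 2.0 license as described in the file LICENSE.
Authors: abc-iut cell, IUT REPAIR / RESCUE-H prover seat abc-iut-rp-d4 (gen 4).
-/
import Summits.ABC.IUTFork.Repair.EvalI06StarShape
import Literature.IUT.LogVolume.UnitLogValuationProfileRealisable
import HarnessLib

/-!
# IUT RESCUE-H (D-0079 «local-height condition I06⋆»), seat abc-iut-rp-d4 — `EvalI06StarShapeRealisable`: at print's own
# `K`-level pilot datum the SHAPE-OPEN cells of I06⋆ are REALISED BOTH WAYS by elements of the chosen idele's norm —
# the kernel form of the «structural ceiling» of the chosen-idele bed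

PROOF-ONLY cells file (D-0012; 0 definitions, 0 `Prop` facts; inputs consumed BY NAME) of the abc-iut cell, IUT REPAIR /
RESCUE-H branch (rung LADDER-ABC:A2.RESCUE-H; R-H table of record `plan/rescue/R-H/I06STAR-COLUMNS.tsv`, col 42 «OPEN-element»;
R-H lead ruling 19:09Z «chosen-idele bed = cell of record»; abc-iut-H-num-1's SEMANTICS FINDING (ii) «OPEN-element = structural
CEILING of the norm-pinned bed — POS (sketch, not kernel)»).  Sequel of this seat's `EvalI06StarShape.lean` (p457897, §2
`shapeOpen_witnesses`).  TAKES NO SIDE on [IUTchIII] Cor. 3.12 or on any author; candidates are hypotheses; typed ≠ proved;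
refuted-AS-TYPED ≠ refuted-in-print.

THE DATUM (as in part I).  `X := pilotDataOfK D K` (abc-iut-C-cert-3), a BAD fibre point `x₀ ∣ p`, `K_w = kOf X p x₀`, the CHOSEN
realising q-idele `q := (exists_realising_qIdeles_pilotDataOfK D).choose p x₀ ∈ K_w`, specified BY ITS NORM ONLY
(`norm_chosenQIdele_eq_unif_zpow`: `‖q‖ = ‖ϖ‖ᵐ`, `m = ord_w(q_E)/(2l)`); `e = e(K_w/ℚ_p)`; the cell «`q ∈ qⁿ·ℐ_w`» has exponent
`t = e − m·(n−1)` (`c = ord_p(p*) = 1`, `pstar_exponent_eq_one`).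

THE CELLS (this file; `(p − 1) ∤ e`, `t = ν(s) = s·p^{a₀} − e·a₀` with `s ≥ 1` and STRICT turning point `a₀ ≥ 1` — exactly the SHAPE-OPEN
rows of part I — and `p ∤ n − 1`, `n ≥ 1`):
* `sameNorm_realised_both_ways` — there are `q₁, q₂ ∈ K_w` with `‖q₁‖ = ‖q₂‖ = ‖q‖`, `q₁ ∈ q₁ⁿ·ℐ_w` and `q₂ ∉ q₂ⁿ·ℐ_w`
  (`ValuationProfile.exists_same_norm_mem_and_not_mem`: every residue class on the sphere of exponent `t` contains log-units and
  non-log-units — `UnitLogValuationProfileCosets` — and `(n−1)`-th roots of principal units exist — `UnitLogPrincipalRoots`).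
* `cell_not_decided_by_chosen_norm` — hence there is NO proposition `d` with `q' ∈ q'ⁿ·ℐ_w ↔ d` for all `q'` of norm `‖q‖`: the
  cell of an idele known only through the realising-norm specification is NOT decided by that specification.  This is the col-42
  verdict «UNDECIDABLE(choice)» as a theorem (for `p ∤ j² − 1`; the `(p−1) ∣ e_w` tie rows and `p ∣ j² − 1` are not treated here).
HONEST SCOPE: statements about OUR typed objects (the real log-shell of [AbsTopIII] Def. 5.4 (iii) at the completion, elements of
`K_w` of the chosen idele's norm); nothing is claimed about the chosen idele ITSELF beyond part I, nor about the genuine root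
`q_E^{1/2l}` (abc-iut-H-num-1's descent / digit columns); the I06⋆ reading is the R-H START-HERE §1 honest reading, NOT a claim
about print's (Ind3); nothing here bears on the truth of [IUTchIII] Cor. 3.12.  [cite: NeukirchANT1999, Ch. II Prop. (5.5), (5.7), (5.8)]
[cite: MochizukiAbsTopIII2015, Def 5.4 (iii) p. 126] [cite: Mochizuki2012, IUTchI Def. 3.1 (b)(c) pp. 61–62, Ex. 3.2 (iv) p. 71]
[cite: DupuyHilado2025, §3.3, §3.4] [claim: Mochizuki2012, status: disputed] for every IUT locution.
-/

noncomputable section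

open Set Function NumberField IsDedekindDomain Metric
open scoped Pointwise

namespace Summit.ABC.IUTFork.Repair.EvalI06StarShapeRealisable

open Literature.IUT.LogVolume Literature.IUT.HodgeTheaters Literature.IUT.LogVolume.ValuationProfile
  Literature.NumberTheory.GaloisRepresentations.Ultrametric Literature.AnabelianGeometry.AbsoluteAnabelian
  Thm311 Thm311.Real Cor312Prov Summit.ABC.IUTFork.Repair.EvalI06StarShape

variable {F K Fbar : Type} [Field F] [NumberField F] [Field K] [NumberField K] [Algebra F K] [Field Fbar]
  [Algebra F Fbar] [Algebra K Fbar] {E : WeierstrassCurve F} [E.IsElliptic] {l : ℕ} {Pb : BadPlacePredicates K}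
  (D : InitialThetaData F K Fbar E l Pb)

/-- **SHAPE-OPEN CELLS ARE REALISED BOTH WAYS AT THE CHOSEN IDELE'S NORM** (`(p − 1) ∤ e`, `p ∤ n − 1`, `n ≥ 1`).  At a bad fibre
point `x₀ ∣ p` of `X = pilotDataOfK D K`, if the cell exponent `t = e − m·(n−1)` (`m = ord_w(q)/(2l)`) is an attained level
`ν(s) = s·p^{a₀} − e·a₀` with `s ≥ 1` and STRICT turning point `a₀ ≥ 1`, then there are `q₁, q₂ ∈ K_w` OF THE SAME NORM as the chosen
realising q-idele with `q₁ ∈ q₁ⁿ·ℐ_w` and `q₂ ∉ q₂ⁿ·ℐ_w` (`ValuationProfile.exists_same_norm_mem_and_not_mem`).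
[cite: NeukirchANT1999, Ch. II Prop. (5.5), (5.7), (5.8)] [cite: MochizukiAbsTopIII2015, Def 5.4 (iii) p. 126] -/
theorem sameNorm_realised_both_ways (pp : Nat.Primes) (x₀ : (thetaIndex (pilotDataOfK D K)).Fibre (.inr pp))
    (hx : haveI : Fact (pp : ℕ).Prime := ⟨pp.2⟩; placeOf (pilotDataOfK D K) pp.1 x₀ ∈ (pilotDataOfK D K).S)
    (hnd : haveI : Fact (pp : ℕ).Prime := ⟨pp.2⟩; ¬ ((pp : ℕ) - 1) ∣ absRamificationIdx (pp : ℕ) (kOf (pilotDataOfK D K) pp.1 x₀))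
    {n : ℕ} (hn : 1 ≤ n) (hpn : ¬ (pp : ℕ) ∣ (n - 1)) {s : ℕ} (hs : 1 ≤ s) {a₀ : ℕ} (ha₀ : a₀ ≠ 0)
    (hlo : haveI : Fact (pp : ℕ).Prime := ⟨pp.2⟩
      ∀ a < a₀, (s : ℤ) * ((pp : ℕ) : ℤ) ^ a * (((pp : ℕ) : ℤ) - 1) < absRamificationIdx (pp : ℕ) (kOf (pilotDataOfK D K) pp.1 x₀))
    (hhi : haveI : Fact (pp : ℕ).Prime := ⟨pp.2⟩
      (absRamificationIdx (pp : ℕ) (kOf (pilotDataOfK D K) pp.1 x₀) : ℤ) < (s : ℤ) * ((pp : ℕ) : ℤ) ^ a₀ * (((pp : ℕ) : ℤ) - 1))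
    (ht : haveI : Fact (pp : ℕ).Prime := ⟨pp.2⟩
      (absRamificationIdx (pp : ℕ) (kOf (pilotDataOfK D K) pp.1 x₀) : ℤ) -
          (pilotDataOfK D K).ordq (placeOf (pilotDataOfK D K) pp.1 x₀) / (2 * (l : ℤ)) * ((n : ℤ) - 1) =
        (s : ℤ) * ((pp : ℕ) : ℤ) ^ a₀ - (absRamificationIdx (pp : ℕ) (kOf (pilotDataOfK D K) pp.1 x₀) : ℤ) * (a₀ : ℤ)) :
    haveI : Fact (pp : ℕ).Prime := ⟨pp.2⟩
    (∃ q : kOf (pilotDataOfK D K) pp.1 x₀, ‖q‖ = ‖(exists_realising_qIdeles_pilotDataOfK D).choose pp x₀‖ ∧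
        q ∈ q ^ n • Literature.AnabelianGeometry.AbsoluteAnabelian.logShell
          (PadicLogOnUnits.ofUnitLog (pp : ℕ) (kOf (pilotDataOfK D K) pp.1 x₀))) ∧
      ∃ q : kOf (pilotDataOfK D K) pp.1 x₀, ‖q‖ = ‖(exists_realising_qIdeles_pilotDataOfK D).choose pp x₀‖ ∧
        q ∉ q ^ n • Literature.AnabelianGeometry.AbsoluteAnabelian.logShell
          (PadicLogOnUnits.ofUnitLog (pp : ℕ) (kOf (pilotDataOfK D K) pp.1 x₀)) := by
  haveI : Fact (pp : ℕ).Prime := ⟨pp.2⟩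
  obtain ⟨ϖ, hϖ⟩ := exists_isUniformizer (F := kOf (pilotDataOfK D K) pp.1 x₀)
  refine exists_same_norm_mem_and_not_mem (pp : ℕ) hnd hϖ hn hpn hs ha₀ hlo hhi ?_
    (norm_chosenQIdele_eq_unif_zpow D pp x₀ hx hϖ)
  rw [pstar_exponent_eq_one D pp x₀ hx]
  simpa using ht

/-- **THE CELL IS NOT DECIDED BY THE CHOSEN IDELE'S NORM** (same hypotheses): there is NO proposition `d` such that
`q' ∈ q'ⁿ·ℐ_w ↔ d` for every `q' ∈ K_w` with `‖q'‖ = ‖q‖`, `q` the chosen realising q-idele at `x₀`.  Since `q` is specified by its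
norm alone, its SHAPE-OPEN cells are undecidable from that specification (col 42 «UNDECIDABLE(choice)»; the genuine-root columns are
a different question). [cite: NeukirchANT1999, Ch. II Prop. (5.5), (5.7), (5.8)] [cite: MochizukiAbsTopIII2015, Def 5.4 (iii) p. 126] -/
theorem cell_not_decided_by_chosen_norm (pp : Nat.Primes) (x₀ : (thetaIndex (pilotDataOfK D K)).Fibre (.inr pp))
    (hx : haveI : Fact (pp : ℕ).Prime := ⟨pp.2⟩; placeOf (pilotDataOfK D K) pp.1 x₀ ∈ (pilotDataOfK D K).S)
    (hnd : haveI : Fact (pp : ℕ).Prime := ⟨pp.2⟩; ¬ ((pp : ℕ) - 1) ∣ absRamificationIdx (pp : ℕ) (kOf (pilotDataOfK D K) pp.1 x₀))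
    {n : ℕ} (hn : 1 ≤ n) (hpn : ¬ (pp : ℕ) ∣ (n - 1)) {s : ℕ} (hs : 1 ≤ s) {a₀ : ℕ} (ha₀ : a₀ ≠ 0)
    (hlo : haveI : Fact (pp : ℕ).Prime := ⟨pp.2⟩
      ∀ a < a₀, (s : ℤ) * ((pp : ℕ) : ℤ) ^ a * (((pp : ℕ) : ℤ) - 1) < absRamificationIdx (pp : ℕ) (kOf (pilotDataOfK D K) pp.1 x₀))
    (hhi : haveI : Fact (pp : ℕ).Prime := ⟨pp.2⟩
      (absRamificationIdx (pp : ℕ) (kOf (pilotDataOfK D K) pp.1 x₀) : ℤ) < (s : ℤ) * ((pp : ℕ) : ℤ) ^ a₀ * (((pp : ℕ) : ℤ) - 1))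
    (ht : haveI : Fact (pp : ℕ).Prime := ⟨pp.2⟩
      (absRamificationIdx (pp : ℕ) (kOf (pilotDataOfK D K) pp.1 x₀) : ℤ) -
          (pilotDataOfK D K).ordq (placeOf (pilotDataOfK D K) pp.1 x₀) / (2 * (l : ℤ)) * ((n : ℤ) - 1) =
        (s : ℤ) * ((pp : ℕ) : ℤ) ^ a₀ - (absRamificationIdx (pp : ℕ) (kOf (pilotDataOfK D K) pp.1 x₀) : ℤ) * (a₀ : ℤ)) :
    haveI : Fact (pp : ℕ).Prime := ⟨pp.2⟩
    ¬ ∃ d : Prop, ∀ q : kOf (pilotDataOfK D K) pp.1 x₀,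
      ‖q‖ = ‖(exists_realising_qIdeles_pilotDataOfK D).choose pp x₀‖ →
        (q ∈ q ^ n • Literature.AnabelianGeometry.AbsoluteAnabelian.logShell
          (PadicLogOnUnits.ofUnitLog (pp : ℕ) (kOf (pilotDataOfK D K) pp.1 x₀)) ↔ d) := by
  haveI : Fact (pp : ℕ).Prime := ⟨pp.2⟩
  rintro ⟨d, hd⟩
  obtain ⟨⟨q₁, hq₁, h₁⟩, ⟨q₂, hq₂, h₂⟩⟩ := sameNorm_realised_both_ways D pp x₀ hx hnd hn hpn hs ha₀ hlo hhi ht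
  exact h₂ ((hd q₂ hq₂).mpr ((hd q₁ hq₁).mp h₁))

end Summit.ABC.IUTFork.Repair.EvalI06StarShapeRealisable

end
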